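import Literature.AlgebraicGeometry.HodgeTheory.PencilCircleHomotopy
import Mathlib.LinearAlgebra.Trace
import HarnessLib

/-!
# The figure-eight of a pencil with two critical values is conjugate to the big circle around both

Family `hodge`, layer `Literature/AlgebraicGeometry/HodgeTheory`; proof file (theorems only: no definition, no
named fact, no `sorry`). Written by the literature-typing seat `littype-FH1-2` (g22, cell `hodge-nonav`) for step (3)
of the programme «A₃-TRACE» of the prover seat `hodge-nonav-prover-Bx` (g16) on the binder hN
`SymmetricA3NonCommutation` (`stub_a3NonComm`) of crux K1-B `VeryGeneralSignCommutatorsInHg` of the route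
`HodgeConjecture/SignSymmetricPowers` (stmt-HodgeConjecture-19716): hN compares THE rational transports `T₁`, `T₂`
along the two circles `γ₁ : b = (ψ/2)e^{2πiθ}` and `γ₂ : b = ψ - (ψ/2)e^{2πiθ}` of the pencil `b ↦ f + b·g`
(`f = f₁ + a'g₂`, `g = g₀`, `ψ = ψ(a')`) around its two critical values `b = 0` and `b = ψ`, based at the midpoint
`b = ψ/2`; the programme needs `tr(T₁ ≫ T₂) = tr(T)` for the transport `T` along a circle `|b| = R` enclosing both
critical values, and then moves the centre `f₁ + a'g₂` of that circle back to `f₁` (`a' → 0`). This file proves the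
underlying plane-topology statements on the tree's carriers.

## The mathematics (AGZV II Part I §2.5, Lemma 2.4 and Fig. 18; Hatcher §1.1 Lemma 1.19; Voisin II §3.1.2)

Let `U(ℂ)` be the base of the universal family of smooth degree-`d` hypersurfaces of `ℙⁿ⁺¹`
(`Motives.UniversalHypersurface.base ℂ n d`; a point `s` is the class of the form `pointForm s`). Fix homogeneous
`f, g` of degree `d`, `ψ ≠ 0` and `R ≥ 3|ψ|/2` such that `f + b·g` is nonsingular for every `b ≠ 0, ψ` with
`|b| ≤ R` (the closed disc of radius `R` of the pencil meets the discriminant only in `b = 0` and `b = ψ`).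

* **The loop going round all the critical values is homotopic to the product of the simple loops** (Arnold,
  Gusein-Zade, Varchenko II, Part I §2.5, the paragraph before Lemma 2.4 and Fig. 18 — whence "the classical
  monodromy is the product of the Picard–Lefschetz operators", Lemma 2.4). Concretely (§1–§2 below): the
  straight-line homotopy `C₁(s,θ) = (1-s)·F(θ) + s·(iRψ/|ψ|)e^{2πiθ}` from the figure-eight
  `F = γ₁·γ₂` (in the `Path.trans` schedule: `F(θ) = (ψ/2)e^{4πiθ}` for `θ ≤ 1/2`, `ψ - (ψ/2)e^{4πiθ}` for
  `θ ≥ 1/2`) to the circle of radius `R` started at `iRψ/|ψ|` never meets `0` or `ψ` and stays in `|b| ≤ R`: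
  writing `e^{2πiθ} = c + iσ` and dividing by `ψ`, on the first half `Im = c((1-s)σ + sR/|ψ|)` with `σ ≥ 0`, on
  the second half `Im = c(sR/|ψ| - (1-s)σ)` with `σ ≤ 0`; so `Im = 0` forces `c = 0` (and then the real part is
  `< 0`, resp. `> 1`, using `R > |ψ|`) or `s = 0, σ = 0` (real part `1/2`) — `first_re_ne`, `second_re_ne`. A
  rotation `C₂(s,θ) = R e^{2πiθ} e^{i(1-s)arg(iψ)}` (norm `R`) then moves the starting point to `R`.
* **A free homotopy of loops conjugates by the track of the base point** (Hatcher, Lemma 1.19 = the tree's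
  `MeridianConj.mk_eq_conj_of_square`, in the pencil form `mk_eq_conj_of_pencilHomotopy` /
  `loopClassUniv_eq_conj_of_pencilHomotopy` of `PencilCircleHomotopy`): hence (§3)
  **`[γ₁·γ₂] = [κ]·[B]·[κ]⁻¹`** in the fundamental groupoid of `U(ℂ)` for every loop `B` with forms
  `f + (Re^{2πiθ})g` at the point `t₁` of `f + Rg`, where `κ` is a path from the midpoint `t₀` to `t₁` all of
  whose forms are `f + b·g` with `b ≠ 0, ψ`, `|b| ≤ R` (`mk_figureEight_eq_conj`, and the same in the indexing
  `loopClassUniv` of the rational transports, `loopClassUniv_figureEight_eq_conj`).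
* **Transport** (Voisin II §3.1.2, the monodromy representation is a functor on the fundamental groupoid; the
  tree's `isRatTransport_conj_of_loopClassUniv_eq`, `IsRatTransport.trans`): if `T₁`, `T₂`, `T` are THE rational
  transports of `Rᵏ π_* ℚ` along `γ₁`, `γ₂`, `B` and `K` the one along `κ`, then
  **`T₁ ≫ T₂ = K ≫ T ≫ K⁻¹`** (`figureEight_ratTransport_eq_conj`), in particular
  **`tr(T₁ ≫ T₂) = tr(T)`** (`figureEight_trace_eq`).
* **Moving the centre** (§5, step B5b of the programme, `a' → 0`): the two-direction lift
  `exists_continuousMap_pointForm_eq_add_smul_add_smul` (forms `f + C(x)g + D(x)g'`) gives the two-direction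
  homotopy lemmas `mk_eq_conj_of_pencilHomotopy₂` / `loopClassUniv_eq_conj_of_pencilHomotopy₂`, whence
  (`exists_path_movingCentre_conj`): if every `f₁ + (s a')g₂ + (re^{2πiθ})g₀`, `s ∈ [0,1]`, is nonsingular, the
  circle `c₀` of forms `f₁ + (re^{2πiθ})g₀` and the circle `c₁` of forms `f₁ + a'g₂ + (re^{2πiθ})g₀` satisfy
  `[c₀] = [α]·[c₁]·[α]⁻¹` for the segment `α` of forms `f₁ + (t a')g₂ + r g₀`; the rational transports are
  conjugate and have equal traces (`movingCentre_ratTransport_eq_conj`).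

Everything is stated on the carriers of `PicardLefschetzNodalForms` / `SymmetricA3NonCommBraid` (`pointForm`,
`loopClassUniv`, `IsRatTransport`, the loop shapes of `SymmetricA3NonCommutation` verbatim with `f := f₁ + a'•g₂`,
`g := g₀`, `ψ := ψ a'`); no new notion is introduced. Nothing here proves hN or HC.

## References

* [ArnoldGuseinzadeVarchenko2012] V. I. Arnold, S. M. Gusein-Zade, A. N. Varchenko, Singularities of Differentiable
  Maps II, Birkhäuser 2012, Part I §2.5 (the loop `τ'` round all the critical values is homotopic to the product
  `τ_μ ⋯ τ_1` of the simple loops, Fig. 18; Lemma 2.4: `h_* = h_1 ⋯ h_μ`), §1.3 (the loops `τ_i`).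
* [Hatcher2002] A. Hatcher, Algebraic Topology, CUP 2002, §1.1 Lemma 1.19 (p. 37): a free homotopy of loops
  conjugates by the track of the base point.
* [VoisinHodgeII2003] C. Voisin, Hodge Theory and Complex Algebraic Geometry II, CUP 2003, §3.1.1–3.1.2 (local
  systems and the monodromy representation, functorial in the path), §2.3.1 (loops around critical values).
-/

noncomputable section

open CategoryTheory AlgebraicGeometry MvPolynomial
open Literature.AlgebraicTopology.SingularHomology
open Literature.AlgebraicGeometry.Motives Literature.AlgebraicGeometry.Motives.UniversalHypersurface
open Literature.AlgebraicGeometry.FundamentalGroup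

namespace Literature.AlgebraicGeometry.HodgeTheory

section HodgeTheory

/-! ### §1 Plane geometry: the straight-line homotopy from the figure-eight to a circle misses `0` and `1` -/

/-- `e^{2πix} = cos 2πx + i sin 2πx`. [folklore] -/
private theorem exp_two_pi_I_eq (x : ℝ) :
    Complex.exp (2 * Real.pi * Complex.I * (x : ℂ)) =
      (Real.cos (2 * Real.pi * x) : ℂ) + (Real.sin (2 * Real.pi * x) : ℂ) * Complex.I := by
  have : 2 * Real.pi * Complex.I * (x : ℂ) = ((2 * Real.pi * x : ℝ) : ℂ) * Complex.I := by push_cast; ring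
  rw [this, Complex.exp_mul_I, ← Complex.ofReal_cos, ← Complex.ofReal_sin]

/-- `e^{2πi(2x)} = (e^{2πix})²`. [folklore] -/
private theorem exp_two_pi_I_two_mul (x : ℝ) :
    Complex.exp (2 * Real.pi * Complex.I * ((2 * x : ℝ) : ℂ)) =
      Complex.exp (2 * Real.pi * Complex.I * (x : ℂ)) ^ 2 := by
  rw [sq, ← Complex.exp_add]; congr 1; push_cast; ring

/-- `e^{2πi(2x-1)} = (e^{2πix})²`. [folklore] -/
private theorem exp_two_pi_I_two_mul_sub_one (x : ℝ) :
    Complex.exp (2 * Real.pi * Complex.I * ((2 * x - 1 : ℝ) : ℂ)) =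
      Complex.exp (2 * Real.pi * Complex.I * (x : ℂ)) ^ 2 := by
  have : 2 * Real.pi * Complex.I * ((2 * x - 1 : ℝ) : ℂ) =
      (2 * Real.pi * Complex.I * (x : ℂ) + 2 * Real.pi * Complex.I * (x : ℂ)) +
        (-1 : ℤ) * (2 * Real.pi * Complex.I) := by
    push_cast; ring
  rw [this, Complex.exp_add, Complex.exp_int_mul_two_pi_mul_I, mul_one, Complex.exp_add, sq]

/-- `|e^{2πix}| = 1`. [folklore] -/
private theorem norm_exp_two_pi_I (x : ℝ) : ‖Complex.exp (2 * Real.pi * Complex.I * (x : ℂ))‖ = 1 := by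
  have : 2 * Real.pi * Complex.I * (x : ℂ) = ((2 * Real.pi * x : ℝ) : ℂ) * Complex.I := by push_cast; ring
  rw [this, Complex.norm_exp_ofReal_mul_I]

/-- `x + iy = 0` with `x, y` real forces `x = y = 0`. [folklore] -/
private theorem ofReal_add_mul_I_eq_zero {x y : ℝ} (h : (x : ℂ) + (y : ℂ) * Complex.I = 0) :
    x = 0 ∧ y = 0 := by
  have h1 := congrArg Complex.re h
  have h2 := congrArg Complex.im h
  simp at h1 h2
  exact ⟨h1, h2⟩

/-- `x + iy = 1` with `x, y` real forces `x = 1`, `y = 0`. [folklore] -/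
private theorem ofReal_add_mul_I_eq_one {x y : ℝ} (h : (x : ℂ) + (y : ℂ) * Complex.I = 1) :
    x = 1 ∧ y = 0 := by
  have h1 := congrArg Complex.re h
  have h2 := congrArg Complex.im h
  simp at h1 h2
  exact ⟨h1, h2⟩

/-- **First half of the figure-eight** (`θ ≤ 1/2`, `σ = sin 2πθ ≥ 0`, `c = cos 2πθ`, `ρ = R/|ψ| > 1`): if the
imaginary part `c((1-s)σ + sρ)` of the homotopy point (divided by `ψ`) vanishes, its real part
`(1-s)(c²-σ²)/2 - sρσ` is neither `0` nor `1`. [cite: ArnoldGuseinzadeVarchenko2012, Part I §2.5 (Fig. 18)] -/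
private theorem first_re_ne {s ρ c sn : ℝ} (hs0 : 0 ≤ s) (hs1 : s ≤ 1) (hρ : 1 < ρ)
    (hcs : c ^ 2 + sn ^ 2 = 1) (hsn : 0 ≤ sn) (hy : c * ((1 - s) * sn + s * ρ) = 0) :
    (1 - s) * ((c ^ 2 - sn ^ 2) / 2) - s * ρ * sn ≠ 0 ∧
      (1 - s) * ((c ^ 2 - sn ^ 2) / 2) - s * ρ * sn ≠ 1 := by
  rcases mul_eq_zero.1 hy with hc | hsum
  · have hsn2 : sn ^ 2 = 1 := by rw [hc] at hcs; simpa using hcs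
    have hsn1 : sn = 1 := by nlinarith
    have h : 0 ≤ s * (ρ - 1 / 2) := mul_nonneg hs0 (by linarith)
    have hx : (1 - s) * ((c ^ 2 - sn ^ 2) / 2) - s * ρ * sn < 0 := by
      rw [hc, hsn1]; nlinarith
    exact ⟨hx.ne, (hx.trans one_pos).ne⟩
  · have h1 : 0 ≤ (1 - s) * sn := mul_nonneg (sub_nonneg.2 hs1) hsn
    have h2 : 0 ≤ s * ρ := mul_nonneg hs0 (by linarith)
    have h3 : s * ρ = 0 := by linarith
    have hs : s = 0 := by
      rcases mul_eq_zero.1 h3 with h | h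
      · exact h
      · exact absurd h (by linarith)
    have hsn0 : sn = 0 := by rw [hs] at hsum; simpa using hsum
    have hc2 : c ^ 2 = 1 := by rw [hsn0] at hcs; simpa using hcs
    have hx : (1 - s) * ((c ^ 2 - sn ^ 2) / 2) - s * ρ * sn = 1 / 2 := by
      rw [hs, hsn0, hc2]; ring
    rw [hx]; norm_num

/-- **Second half of the figure-eight** (`θ ≥ 1/2`, `σ = sin 2πθ ≤ 0`): if the imaginary part
`c(sρ - (1-s)σ)` vanishes, the real part `(1-s)(1 - (c²-σ²)/2) - sρσ` is neither `0` nor `1`.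
[cite: ArnoldGuseinzadeVarchenko2012, Part I §2.5 (Fig. 18)] -/
private theorem second_re_ne {s ρ c sn : ℝ} (hs0 : 0 ≤ s) (hs1 : s ≤ 1) (hρ : 1 < ρ)
    (hcs : c ^ 2 + sn ^ 2 = 1) (hsn : sn ≤ 0) (hy : c * (s * ρ - (1 - s) * sn) = 0) :
    (1 - s) * (1 - (c ^ 2 - sn ^ 2) / 2) - s * ρ * sn ≠ 0 ∧
      (1 - s) * (1 - (c ^ 2 - sn ^ 2) / 2) - s * ρ * sn ≠ 1 := by
  rcases mul_eq_zero.1 hy with hc | hsum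
  · have hsn2 : sn ^ 2 = 1 := by rw [hc] at hcs; simpa using hcs
    have hsn1 : sn = -1 := by nlinarith
    have h : s ≤ s * ρ := by nlinarith
    have hx : 1 < (1 - s) * (1 - (c ^ 2 - sn ^ 2) / 2) - s * ρ * sn := by
      rw [hc, hsn1]
      rcases eq_or_lt_of_le hs1 with h' | h'
      · rw [h']; nlinarith
      · nlinarith
    exact ⟨(one_pos.trans hx).ne', hx.ne'⟩
  · have h1 : (1 - s) * sn ≤ 0 := mul_nonpos_of_nonneg_of_nonpos (sub_nonneg.2 hs1) hsn
    have h2 : 0 ≤ s * ρ := mul_nonneg hs0 (by linarith)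
    have h3 : s * ρ = 0 := by linarith
    have hs : s = 0 := by
      rcases mul_eq_zero.1 h3 with h | h
      · exact h
      · exact absurd h (by linarith)
    have hsn0 : sn = 0 := by rw [hs] at hsum; simpa using hsum
    have hc2 : c ^ 2 = 1 := by rw [hsn0] at hcs; simpa using hcs
    have hx : (1 - s) * (1 - (c ^ 2 - sn ^ 2) / 2) - s * ρ * sn = 1 / 2 := by
      rw [hs, hsn0, hc2]; ring
    rw [hx]; norm_num

/-- Real and imaginary parts of the homotopy point on the first half. [folklore] -/
private theorem first_eq (s ρ c sn : ℝ) :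
    (1 - (s : ℂ)) * (1 / 2 * ((c : ℂ) + (sn : ℂ) * Complex.I) ^ 2) +
        (s : ℂ) * (Complex.I * (ρ : ℂ) * ((c : ℂ) + (sn : ℂ) * Complex.I)) =
      (((1 - s) * ((c ^ 2 - sn ^ 2) / 2) - s * ρ * sn : ℝ) : ℂ) +
        ((c * ((1 - s) * sn + s * ρ) : ℝ) : ℂ) * Complex.I := by
  apply Complex.ext <;>
    simp only [sq, Complex.add_re, Complex.mul_re, Complex.sub_re, Complex.one_re, Complex.ofReal_re,
      Complex.ofReal_im, Complex.I_re, Complex.I_im, Complex.add_im, Complex.mul_im, Complex.sub_im,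
      Complex.one_im, Complex.div_ofNat_re, Complex.div_ofNat_im] <;> ring

/-- Real and imaginary parts of the homotopy point on the second half. [folklore] -/
private theorem second_eq (s ρ c sn : ℝ) :
    (1 - (s : ℂ)) * (1 - 1 / 2 * ((c : ℂ) + (sn : ℂ) * Complex.I) ^ 2) +
        (s : ℂ) * (Complex.I * (ρ : ℂ) * ((c : ℂ) + (sn : ℂ) * Complex.I)) =
      (((1 - s) * (1 - (c ^ 2 - sn ^ 2) / 2) - s * ρ * sn : ℝ) : ℂ) +
        ((c * (s * ρ - (1 - s) * sn) : ℝ) : ℂ) * Complex.I := by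
  apply Complex.ext <;>
    simp only [sq, Complex.add_re, Complex.mul_re, Complex.sub_re, Complex.one_re, Complex.ofReal_re,
      Complex.ofReal_im, Complex.I_re, Complex.I_im, Complex.add_im, Complex.mul_im, Complex.sub_im,
      Complex.one_im, Complex.div_ofNat_re, Complex.div_ofNat_im] <;> ring

/-- **First half**: for `0 ≤ x ≤ 1/2`, `s ∈ [0,1]`, `ρ > 1`, the point
`(1-s)·½e^{2πi(2x)} + s·iρe^{2πix}` is neither `0` nor `1`. [cite: ArnoldGuseinzadeVarchenko2012, Part I §2.5 (Fig. 18)] -/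
private theorem first_ne (s : unitInterval) {ρ x : ℝ} (hρ : 1 < ρ) (hx0 : 0 ≤ x) (hx : x ≤ 1 / 2) :
    (1 - ((s : ℝ) : ℂ)) * (1 / 2 * Complex.exp (2 * Real.pi * Complex.I * ((2 * x : ℝ) : ℂ))) +
        ((s : ℝ) : ℂ) * (Complex.I * (ρ : ℂ) * Complex.exp (2 * Real.pi * Complex.I * (x : ℂ))) ≠ 0 ∧
      (1 - ((s : ℝ) : ℂ)) * (1 / 2 * Complex.exp (2 * Real.pi * Complex.I * ((2 * x : ℝ) : ℂ))) +
        ((s : ℝ) : ℂ) * (Complex.I * (ρ : ℂ) * Complex.exp (2 * Real.pi * Complex.I * (x : ℂ))) ≠ 1 := by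
  rw [exp_two_pi_I_two_mul, exp_two_pi_I_eq, first_eq]
  have hcs : Real.cos (2 * Real.pi * x) ^ 2 + Real.sin (2 * Real.pi * x) ^ 2 = 1 :=
    Real.cos_sq_add_sin_sq _
  have hsn : 0 ≤ Real.sin (2 * Real.pi * x) :=
    Real.sin_nonneg_of_nonneg_of_le_pi (mul_nonneg (by positivity) hx0) (by nlinarith [Real.pi_pos])
  refine ⟨fun h => ?_, fun h => ?_⟩
  · obtain ⟨h1, h2⟩ := ofReal_add_mul_I_eq_zero h
    exact (first_re_ne s.2.1 s.2.2 hρ hcs hsn h2).1 h1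
  · obtain ⟨h1, h2⟩ := ofReal_add_mul_I_eq_one h
    exact (first_re_ne s.2.1 s.2.2 hρ hcs hsn h2).2 h1

/-- **Second half**: for `1/2 ≤ x ≤ 1`, `s ∈ [0,1]`, `ρ > 1`, the point
`(1-s)·(1 - ½e^{2πi(2x-1)}) + s·iρe^{2πix}` is neither `0` nor `1`. [cite: ArnoldGuseinzadeVarchenko2012, Part I §2.5 (Fig. 18)] -/
private theorem second_ne (s : unitInterval) {ρ x : ℝ} (hρ : 1 < ρ) (hx : 1 / 2 ≤ x) (hx1 : x ≤ 1) :
    (1 - ((s : ℝ) : ℂ)) * (1 - 1 / 2 * Complex.exp (2 * Real.pi * Complex.I * ((2 * x - 1 : ℝ) : ℂ))) +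
        ((s : ℝ) : ℂ) * (Complex.I * (ρ : ℂ) * Complex.exp (2 * Real.pi * Complex.I * (x : ℂ))) ≠ 0 ∧
      (1 - ((s : ℝ) : ℂ)) * (1 - 1 / 2 * Complex.exp (2 * Real.pi * Complex.I * ((2 * x - 1 : ℝ) : ℂ))) +
        ((s : ℝ) : ℂ) * (Complex.I * (ρ : ℂ) * Complex.exp (2 * Real.pi * Complex.I * (x : ℂ))) ≠ 1 := by
  rw [exp_two_pi_I_two_mul_sub_one, exp_two_pi_I_eq, second_eq]
  have hcs : Real.cos (2 * Real.pi * x) ^ 2 + Real.sin (2 * Real.pi * x) ^ 2 = 1 :=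
    Real.cos_sq_add_sin_sq _
  have hsn : Real.sin (2 * Real.pi * x) ≤ 0 := by
    rw [← neg_neg (Real.sin _), ← Real.sin_sub_pi, neg_nonpos]
    exact Real.sin_nonneg_of_nonneg_of_le_pi (by nlinarith [Real.pi_pos]) (by nlinarith [Real.pi_pos])
  refine ⟨fun h => ?_, fun h => ?_⟩
  · obtain ⟨h1, h2⟩ := ofReal_add_mul_I_eq_zero h
    exact (second_re_ne s.2.1 s.2.2 hρ hcs hsn h2).1 h1
  · obtain ⟨h1, h2⟩ := ofReal_add_mul_I_eq_one h
    exact (second_re_ne s.2.1 s.2.2 hρ hcs hsn h2).2 h1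

/-! ### §2 The straight-line homotopy `C₁` from the figure-eight (in the `Path.trans` schedule) to the circle of
radius `R` started at `iRψ/|ψ|`, and the rotation `C₂` of that circle to the one started at `R` -/

/-- The figure-eight `θ ↦ ½e^{4πiθ}` (`θ ≤ ½`), `1 - ½e^{2πi(2θ-1)}` (`θ ≥ ½`) is continuous (the two halves
agree at `θ = ½`). [cite: ArnoldGuseinzadeVarchenko2012, Part I §2.5 (Fig. 18)] -/
private theorem continuous_fig8 : Continuous fun θ : unitInterval =>
    (if (θ : ℝ) ≤ 1 / 2 then
        1 / 2 * Complex.exp (2 * Real.pi * Complex.I * ((2 * (θ : ℝ) : ℝ) : ℂ))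
      else 1 - 1 / 2 * Complex.exp (2 * Real.pi * Complex.I * ((2 * (θ : ℝ) - 1 : ℝ) : ℂ))) := by
  refine Continuous.if_le (by fun_prop) (by fun_prop) (by fun_prop) continuous_const fun θ hθ => ?_
  simp [hθ]
  norm_num

/-- The straight-line homotopy `C₁(s,θ) = ψ·((1-s)·F(θ) + s·iρe^{2πiθ})` is continuous. [folklore] -/
private theorem continuous_fig8Homotopy (ψ : ℂ) (ρ : ℝ) :
    Continuous fun p : unitInterval × unitInterval =>
      ψ * ((1 - ((p.1 : ℝ) : ℂ)) *
          (if (p.2 : ℝ) ≤ 1 / 2 then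
              1 / 2 * Complex.exp (2 * Real.pi * Complex.I * ((2 * (p.2 : ℝ) : ℝ) : ℂ))
            else 1 - 1 / 2 * Complex.exp (2 * Real.pi * Complex.I * ((2 * (p.2 : ℝ) - 1 : ℝ) : ℂ))) +
        ((p.1 : ℝ) : ℂ) * (Complex.I * (ρ : ℂ) * Complex.exp (2 * Real.pi * Complex.I * ((p.2 : ℝ) : ℂ)))) := by
  refine continuous_const.mul ((Continuous.mul (by fun_prop) (continuous_fig8.comp continuous_snd)).add ?_)
  fun_prop

/-- **The straight-line homotopy misses both critical values and stays in the disc of radius `R`**: for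
`ψ ≠ 0`, `3|ψ|/2 ≤ R` and `ρ = R/|ψ|`, every `C₁(s,θ)` is `≠ 0`, `≠ ψ` and has norm `≤ R`.
[cite: ArnoldGuseinzadeVarchenko2012, Part I §2.5 (the loop round all the critical values ≃ the product of the simple loops, Fig. 18)] -/
private theorem fig8Homotopy_mem {ψ : ℂ} {R : ℝ} (hψ : ψ ≠ 0) (hR : 3 / 2 * ‖ψ‖ ≤ R)
    (s θ : unitInterval) :
    ψ * ((1 - ((s : ℝ) : ℂ)) *
          (if (θ : ℝ) ≤ 1 / 2 then
              1 / 2 * Complex.exp (2 * Real.pi * Complex.I * ((2 * (θ : ℝ) : ℝ) : ℂ))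
            else 1 - 1 / 2 * Complex.exp (2 * Real.pi * Complex.I * ((2 * (θ : ℝ) - 1 : ℝ) : ℂ))) +
        ((s : ℝ) : ℂ) * (Complex.I * ((R / ‖ψ‖ : ℝ) : ℂ) *
          Complex.exp (2 * Real.pi * Complex.I * ((θ : ℝ) : ℂ)))) ≠ 0 ∧
    ψ * ((1 - ((s : ℝ) : ℂ)) *
          (if (θ : ℝ) ≤ 1 / 2 then
              1 / 2 * Complex.exp (2 * Real.pi * Complex.I * ((2 * (θ : ℝ) : ℝ) : ℂ))
            else 1 - 1 / 2 * Complex.exp (2 * Real.pi * Complex.I * ((2 * (θ : ℝ) - 1 : ℝ) : ℂ))) +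
        ((s : ℝ) : ℂ) * (Complex.I * ((R / ‖ψ‖ : ℝ) : ℂ) *
          Complex.exp (2 * Real.pi * Complex.I * ((θ : ℝ) : ℂ)))) ≠ ψ ∧
    ‖ψ * ((1 - ((s : ℝ) : ℂ)) *
          (if (θ : ℝ) ≤ 1 / 2 then
              1 / 2 * Complex.exp (2 * Real.pi * Complex.I * ((2 * (θ : ℝ) : ℝ) : ℂ))
            else 1 - 1 / 2 * Complex.exp (2 * Real.pi * Complex.I * ((2 * (θ : ℝ) - 1 : ℝ) : ℂ))) +
        ((s : ℝ) : ℂ) * (Complex.I * ((R / ‖ψ‖ : ℝ) : ℂ) *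
          Complex.exp (2 * Real.pi * Complex.I * ((θ : ℝ) : ℂ))))‖ ≤ R := by
  have hψ0 : 0 < ‖ψ‖ := norm_pos_iff.2 hψ
  have hρ : 1 < R / ‖ψ‖ := (one_lt_div hψ0).2 (by linarith)
  have hR0 : 0 ≤ R := le_trans (by positivity) hR
  have hW : ((1 - ((s : ℝ) : ℂ)) *
          (if (θ : ℝ) ≤ 1 / 2 then
              1 / 2 * Complex.exp (2 * Real.pi * Complex.I * ((2 * (θ : ℝ) : ℝ) : ℂ))
            else 1 - 1 / 2 * Complex.exp (2 * Real.pi * Complex.I * ((2 * (θ : ℝ) - 1 : ℝ) : ℂ))) +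
        ((s : ℝ) : ℂ) * (Complex.I * ((R / ‖ψ‖ : ℝ) : ℂ) *
          Complex.exp (2 * Real.pi * Complex.I * ((θ : ℝ) : ℂ)))) ≠ 0 ∧
      ((1 - ((s : ℝ) : ℂ)) *
          (if (θ : ℝ) ≤ 1 / 2 then
              1 / 2 * Complex.exp (2 * Real.pi * Complex.I * ((2 * (θ : ℝ) : ℝ) : ℂ))
            else 1 - 1 / 2 * Complex.exp (2 * Real.pi * Complex.I * ((2 * (θ : ℝ) - 1 : ℝ) : ℂ))) +
        ((s : ℝ) : ℂ) * (Complex.I * ((R / ‖ψ‖ : ℝ) : ℂ) *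
          Complex.exp (2 * Real.pi * Complex.I * ((θ : ℝ) : ℂ)))) ≠ 1 := by
    split_ifs with h
    · exact first_ne s hρ θ.2.1 h
    · exact second_ne s hρ (le_of_lt (not_le.1 h)) θ.2.2
  have hE : ‖(if (θ : ℝ) ≤ 1 / 2 then
              1 / 2 * Complex.exp (2 * Real.pi * Complex.I * ((2 * (θ : ℝ) : ℝ) : ℂ))
            else 1 - 1 / 2 * Complex.exp (2 * Real.pi * Complex.I * ((2 * (θ : ℝ) - 1 : ℝ) : ℂ)))‖ ≤
      3 / 2 := by
    split_ifs
    · rw [norm_mul, norm_exp_two_pi_I, mul_one]; norm_num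
    · refine (norm_sub_le _ _).trans ?_
      rw [norm_one, norm_mul, norm_exp_two_pi_I, mul_one]; norm_num
  refine ⟨mul_ne_zero hψ hW.1, fun h => hW.2 (mul_left_cancel₀ hψ (h.trans (mul_one ψ).symm)), ?_⟩
  have h1 : ‖(1 - ((s : ℝ) : ℂ)) *
          (if (θ : ℝ) ≤ 1 / 2 then
              1 / 2 * Complex.exp (2 * Real.pi * Complex.I * ((2 * (θ : ℝ) : ℝ) : ℂ))
            else 1 - 1 / 2 * Complex.exp (2 * Real.pi * Complex.I * ((2 * (θ : ℝ) - 1 : ℝ) : ℂ)))‖ ≤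
      (1 - (s : ℝ)) * (3 / 2) := by
    rw [norm_mul, show (1 - ((s : ℝ) : ℂ)) = (((1 - (s : ℝ) : ℝ)) : ℂ) by push_cast; ring, Complex.norm_real,
      Real.norm_of_nonneg (sub_nonneg.2 s.2.2)]
    exact mul_le_mul_of_nonneg_left hE (sub_nonneg.2 s.2.2)
  have h2 : ‖((s : ℝ) : ℂ) * (Complex.I * ((R / ‖ψ‖ : ℝ) : ℂ) *
          Complex.exp (2 * Real.pi * Complex.I * ((θ : ℝ) : ℂ)))‖ = (s : ℝ) * (R / ‖ψ‖) := by
    rw [norm_mul, norm_mul, norm_mul, Complex.norm_real, Complex.norm_real, Complex.norm_I,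
      norm_exp_two_pi_I, Real.norm_of_nonneg s.2.1, Real.norm_of_nonneg (div_nonneg hR0 hψ0.le), one_mul,
      mul_one]
  rw [norm_mul]
  calc ‖ψ‖ * _ ≤ ‖ψ‖ * ((1 - (s : ℝ)) * (3 / 2) + (s : ℝ) * (R / ‖ψ‖)) :=
        mul_le_mul_of_nonneg_left ((norm_add_le _ _).trans (add_le_add h1 h2.le)) (norm_nonneg _)
    _ = (1 - (s : ℝ)) * (3 / 2 * ‖ψ‖) + (s : ℝ) * R := by field_simp
    _ ≤ (1 - (s : ℝ)) * R + (s : ℝ) * R := by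
        have := mul_le_mul_of_nonneg_left hR (sub_nonneg.2 s.2.2); linarith
    _ = R := by ring

/-- **At `s = 0` the homotopy is the figure-eight in the `Path.trans` schedule**: `(ψ/2)e^{2πi(2θ)}` for
`θ ≤ ½` and `ψ - (ψ/2)e^{2πi(2θ-1)}` for `θ > ½`. [cite: ArnoldGuseinzadeVarchenko2012, Part I §2.5 (Fig. 18)] -/
private theorem fig8Homotopy_zero_left (ψ : ℂ) (ρ : ℝ) (θ : unitInterval) :
    ψ * ((1 - (((0 : unitInterval) : ℝ) : ℂ)) *
          (if (θ : ℝ) ≤ 1 / 2 then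
              1 / 2 * Complex.exp (2 * Real.pi * Complex.I * ((2 * (θ : ℝ) : ℝ) : ℂ))
            else 1 - 1 / 2 * Complex.exp (2 * Real.pi * Complex.I * ((2 * (θ : ℝ) - 1 : ℝ) : ℂ))) +
        (((0 : unitInterval) : ℝ) : ℂ) * (Complex.I * (ρ : ℂ) *
          Complex.exp (2 * Real.pi * Complex.I * ((θ : ℝ) : ℂ)))) =
      if (θ : ℝ) ≤ 1 / 2 then ψ / 2 * Complex.exp (2 * Real.pi * Complex.I * ((2 * (θ : ℝ) : ℝ) : ℂ))
      else ψ - ψ / 2 * Complex.exp (2 * Real.pi * Complex.I * ((2 * (θ : ℝ) - 1 : ℝ) : ℂ)) := by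
  simp only [Set.Icc.coe_zero, Complex.ofReal_zero, sub_zero, one_mul, zero_mul, add_zero]
  split_ifs <;> ring

/-- The base point of the straight-line homotopy is the same at `θ = 0` and `θ = 1`. [folklore] -/
private theorem fig8Homotopy_bottom_eq_top (ψ : ℂ) (ρ : ℝ) (s : unitInterval) :
    ψ * ((1 - ((s : ℝ) : ℂ)) *
          (if (((0 : unitInterval) : ℝ)) ≤ 1 / 2 then
              1 / 2 * Complex.exp (2 * Real.pi * Complex.I * ((2 * ((0 : unitInterval) : ℝ) : ℝ) : ℂ))
            else 1 - 1 / 2 * Complex.exp (2 * Real.pi * Complex.I *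
              ((2 * ((0 : unitInterval) : ℝ) - 1 : ℝ) : ℂ))) +
        ((s : ℝ) : ℂ) * (Complex.I * (ρ : ℂ) *
          Complex.exp (2 * Real.pi * Complex.I * (((0 : unitInterval) : ℝ) : ℂ)))) =
    ψ * ((1 - ((s : ℝ) : ℂ)) *
          (if (((1 : unitInterval) : ℝ)) ≤ 1 / 2 then
              1 / 2 * Complex.exp (2 * Real.pi * Complex.I * ((2 * ((1 : unitInterval) : ℝ) : ℝ) : ℂ))
            else 1 - 1 / 2 * Complex.exp (2 * Real.pi * Complex.I *
              ((2 * ((1 : unitInterval) : ℝ) - 1 : ℝ) : ℂ))) +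
        ((s : ℝ) : ℂ) * (Complex.I * (ρ : ℂ) *
          Complex.exp (2 * Real.pi * Complex.I * (((1 : unitInterval) : ℝ) : ℂ)))) := by
  norm_num [Complex.exp_two_pi_mul_I]

/-- The rotation `C₂(s,θ) = R e^{2πiθ} e^{i(1-s)arg(iψ)}` is continuous. [folklore] -/
private theorem continuous_rotHomotopy (ψ : ℂ) (R : ℝ) :
    Continuous fun p : unitInterval × unitInterval =>
      (R : ℂ) * Complex.exp (2 * Real.pi * Complex.I * ((p.2 : ℝ) : ℂ)) *
        Complex.exp ((((1 - (p.1 : ℝ)) * Complex.arg (Complex.I * ψ) : ℝ) : ℂ) * Complex.I) := by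
  fun_prop

/-- Every point of the rotation has norm `R` (`R ≥ 0`). [folklore] -/
private theorem norm_rotHomotopy (ψ : ℂ) {R : ℝ} (hR : 0 ≤ R) (s θ : unitInterval) :
    ‖(R : ℂ) * Complex.exp (2 * Real.pi * Complex.I * ((θ : ℝ) : ℂ)) *
        Complex.exp ((((1 - (s : ℝ)) * Complex.arg (Complex.I * ψ) : ℝ) : ℂ) * Complex.I)‖ = R := by
  rw [norm_mul, norm_mul, Complex.norm_real, norm_exp_two_pi_I, Complex.norm_exp_ofReal_mul_I, mul_one,
    mul_one, Real.norm_of_nonneg hR]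

/-- At `s = 0` the rotation is the end `s = 1` of the straight-line homotopy, the circle `iRψ/|ψ|·e^{2πiθ}`
(`|iψ|e^{i arg(iψ)} = iψ`). [folklore] -/
private theorem rotHomotopy_zero_left {ψ : ℂ} (hψ : ψ ≠ 0) (R : ℝ) (θ : unitInterval) :
    (R : ℂ) * Complex.exp (2 * Real.pi * Complex.I * ((θ : ℝ) : ℂ)) *
        Complex.exp ((((1 - ((0 : unitInterval) : ℝ)) * Complex.arg (Complex.I * ψ) : ℝ) : ℂ) * Complex.I) =
    ψ * ((1 - (((1 : unitInterval) : ℝ) : ℂ)) *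
          (if (θ : ℝ) ≤ 1 / 2 then
              1 / 2 * Complex.exp (2 * Real.pi * Complex.I * ((2 * (θ : ℝ) : ℝ) : ℂ))
            else 1 - 1 / 2 * Complex.exp (2 * Real.pi * Complex.I * ((2 * (θ : ℝ) - 1 : ℝ) : ℂ))) +
        (((1 : unitInterval) : ℝ) : ℂ) * (Complex.I * ((R / ‖ψ‖ : ℝ) : ℂ) *
          Complex.exp (2 * Real.pi * Complex.I * ((θ : ℝ) : ℂ)))) := by
  have hn : ‖Complex.I * ψ‖ = ‖ψ‖ := by rw [norm_mul, Complex.norm_I, one_mul]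
  have hψ0 : (‖ψ‖ : ℂ) ≠ 0 := by exact_mod_cast (norm_pos_iff.2 hψ).ne'
  have key : Complex.exp ((Complex.arg (Complex.I * ψ) : ℂ) * Complex.I) = (‖ψ‖ : ℂ)⁻¹ * (Complex.I * ψ) := by
    have h := Complex.norm_mul_exp_arg_mul_I (Complex.I * ψ)
    rw [hn] at h
    calc Complex.exp ((Complex.arg (Complex.I * ψ) : ℂ) * Complex.I)
        = (‖ψ‖ : ℂ)⁻¹ * ((‖ψ‖ : ℂ) * Complex.exp ((Complex.arg (Complex.I * ψ) : ℂ) * Complex.I)) := by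
          rw [← mul_assoc, inv_mul_cancel₀ hψ0, one_mul]
      _ = (‖ψ‖ : ℂ)⁻¹ * (Complex.I * ψ) := by rw [h]
  simp only [Set.Icc.coe_zero, Set.Icc.coe_one, sub_zero, one_mul, Complex.ofReal_one, sub_self,
    zero_mul, zero_add, Complex.ofReal_div]
  rw [key, div_eq_mul_inv]
  ring

/-- At `s = 1` the rotation is the circle `R e^{2πiθ}`. [folklore] -/
private theorem rotHomotopy_one_left (ψ : ℂ) (R : ℝ) (θ : unitInterval) :
    (R : ℂ) * Complex.exp (2 * Real.pi * Complex.I * ((θ : ℝ) : ℂ)) *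
        Complex.exp ((((1 - ((1 : unitInterval) : ℝ)) * Complex.arg (Complex.I * ψ) : ℝ) : ℂ) * Complex.I) =
      (R : ℂ) * Complex.exp (2 * Real.pi * Complex.I * ((θ : ℝ) : ℂ)) := by
  simp

/-- The base point of the rotation is the same at `θ = 0` and `θ = 1`. [folklore] -/
private theorem rotHomotopy_bottom_eq_top (ψ : ℂ) (R : ℝ) (s : unitInterval) :
    (R : ℂ) * Complex.exp (2 * Real.pi * Complex.I * (((0 : unitInterval) : ℝ) : ℂ)) *
        Complex.exp ((((1 - (s : ℝ)) * Complex.arg (Complex.I * ψ) : ℝ) : ℂ) * Complex.I) =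
      (R : ℂ) * Complex.exp (2 * Real.pi * Complex.I * (((1 : unitInterval) : ℝ) : ℂ)) *
        Complex.exp ((((1 - (s : ℝ)) * Complex.arg (Complex.I * ψ) : ℝ) : ℂ) * Complex.I) := by
  simp [Complex.exp_two_pi_mul_I]

/-! ### §3 The figure-eight `γ₁·γ₂` is conjugate to the big circle in the fundamental groupoid of `U(ℂ)` -/

variable {n d : ℕ}

/-- **Homotopy data** (internal): the two coefficient homotopies `C₁` (figure-eight → circle started at
`iRψ/|ψ|`) and `C₂` (rotation to the circle started at `R`), their lifts — the intermediate loop `c₁`, the tracks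
`α`, `β` of the base point — and the identities of forms that `mk_eq_conj_of_pencilHomotopy` consumes.
[cite: ArnoldGuseinzadeVarchenko2012, Part I §2.5 (Fig. 18)] [cite: VoisinHodgeII2003, §6.2.1] -/
private theorem exists_figureEight_data {f g : MvPolynomial (Fin (n + 2)) ℂ} (hf : f.IsHomogeneous d)
    (hg : g.IsHomogeneous d) {ψ : ℂ} (hψ : ψ ≠ 0) {R : ℝ} (hR : 3 / 2 * ‖ψ‖ ≤ R)
    (hJ : ∀ b : ℂ, b ≠ 0 → b ≠ ψ → ‖b‖ ≤ R → SmoothHypersurface.IsNonsingularForm ℂ (f + b • g))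
    {t₀ t₁ : ComplexPoints (base ℂ n d)} (γ₁ γ₂ : Path t₀ t₀) (B : Path t₁ t₁)
    (h₁ : ∀ θ : unitInterval, pointForm ℂ n d (γ₁ θ) =
      f + (ψ / 2 * Complex.exp (2 * Real.pi * Complex.I * ((θ : ℝ) : ℂ))) • g)
    (h₂ : ∀ θ : unitInterval, pointForm ℂ n d (γ₂ θ) =
      f + (ψ - ψ / 2 * Complex.exp (2 * Real.pi * Complex.I * ((θ : ℝ) : ℂ))) • g)
    (hB : ∀ θ : unitInterval, pointForm ℂ n d (B θ) =
      f + ((R : ℂ) * Complex.exp (2 * Real.pi * Complex.I * ((θ : ℝ) : ℂ))) • g) :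
    ∃ (C₁ C₂ : unitInterval × unitInterval → ℂ) (e₁ : ComplexPoints (base ℂ n d)) (c₁ : Path e₁ e₁)
      (α : Path t₀ e₁) (β : Path e₁ t₁),
      Continuous C₁ ∧ Continuous C₂ ∧
      (∀ p, SmoothHypersurface.IsNonsingularForm ℂ (f + C₁ p • g)) ∧
      (∀ p, SmoothHypersurface.IsNonsingularForm ℂ (f + C₂ p • g)) ∧
      (∀ θ, pointForm ℂ n d ((γ₁.trans γ₂) θ) = f + C₁ (0, θ) • g) ∧
      (∀ θ, pointForm ℂ n d (c₁ θ) = f + C₁ (1, θ) • g) ∧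
      (∀ t, pointForm ℂ n d (α t) = f + C₁ (t, 0) • g) ∧
      (∀ t, pointForm ℂ n d (α t) = f + C₁ (t, 1) • g) ∧
      (∀ θ, pointForm ℂ n d (c₁ θ) = f + C₂ (0, θ) • g) ∧
      (∀ θ, pointForm ℂ n d (B θ) = f + C₂ (1, θ) • g) ∧
      (∀ t, pointForm ℂ n d (β t) = f + C₂ (t, 0) • g) ∧
      (∀ t, pointForm ℂ n d (β t) = f + C₂ (t, 1) • g) ∧
      (∀ t, ∃ b : ℂ, b ≠ 0 ∧ b ≠ ψ ∧ ‖b‖ ≤ R ∧ pointForm ℂ n d ((α.trans β) t) = f + b • g) := by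
  obtain ⟨C₁, hC₁⟩ : ∃ C₁ : unitInterval × unitInterval → ℂ, C₁ = fun p =>
      ψ * ((1 - ((p.1 : ℝ) : ℂ)) *
          (if (p.2 : ℝ) ≤ 1 / 2 then
              1 / 2 * Complex.exp (2 * Real.pi * Complex.I * ((2 * (p.2 : ℝ) : ℝ) : ℂ))
            else 1 - 1 / 2 * Complex.exp (2 * Real.pi * Complex.I * ((2 * (p.2 : ℝ) - 1 : ℝ) : ℂ))) +
        ((p.1 : ℝ) : ℂ) * (Complex.I * ((R / ‖ψ‖ : ℝ) : ℂ) *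
          Complex.exp (2 * Real.pi * Complex.I * ((p.2 : ℝ) : ℂ)))) := ⟨_, rfl⟩
  obtain ⟨C₂, hC₂⟩ : ∃ C₂ : unitInterval × unitInterval → ℂ, C₂ = fun p =>
      (R : ℂ) * Complex.exp (2 * Real.pi * Complex.I * ((p.2 : ℝ) : ℂ)) *
        Complex.exp ((((1 - (p.1 : ℝ)) * Complex.arg (Complex.I * ψ) : ℝ) : ℂ) * Complex.I) := ⟨_, rfl⟩
  have hψ0 : 0 < ‖ψ‖ := norm_pos_iff.2 hψ
  have hR0 : 0 ≤ R := le_trans (by positivity) hR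
  have hψR : ‖ψ‖ < R := by linarith
  have hC₁c : Continuous C₁ := by rw [hC₁]; exact continuous_fig8Homotopy ψ _
  have hC₂c : Continuous C₂ := by rw [hC₂]; exact continuous_rotHomotopy ψ R
  have hmem₁ : ∀ p, C₁ p ≠ 0 ∧ C₁ p ≠ ψ ∧ ‖C₁ p‖ ≤ R := fun p => by
    simp only [hC₁]
    exact fig8Homotopy_mem hψ hR p.1 p.2
  have hmem₂ : ∀ p, C₂ p ≠ 0 ∧ C₂ p ≠ ψ ∧ ‖C₂ p‖ ≤ R := fun p => by
    have hn : ‖C₂ p‖ = R := by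
      simp only [hC₂]
      exact norm_rotHomotopy ψ hR0 p.1 p.2
    refine ⟨fun h => ?_, fun h => ?_, hn.le⟩
    · rw [h, norm_zero] at hn
      linarith
    · rw [h] at hn
      linarith
  have hJ₁ : ∀ p, SmoothHypersurface.IsNonsingularForm ℂ (f + C₁ p • g) := fun p =>
    hJ _ (hmem₁ p).1 (hmem₁ p).2.1 (hmem₁ p).2.2
  have hJ₂ : ∀ p, SmoothHypersurface.IsNonsingularForm ℂ (f + C₂ p • g) := fun p =>
    hJ _ (hmem₂ p).1 (hmem₂ p).2.1 (hmem₂ p).2.2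
  -- the figure-eight `γ₁·γ₂` is the loop of forms `f + C₁(0,θ)g`
  have h0 : ∀ θ, pointForm ℂ n d ((γ₁.trans γ₂) θ) = f + C₁ (0, θ) • g := fun θ => by
    rw [Path.trans_apply]
    simp only [hC₁]
    rw [fig8Homotopy_zero_left]
    split_ifs with h
    exacts [h₁ _, h₂ _]
  have h00 : pointForm ℂ n d t₀ = f + C₁ (0, 0) • g := by
    have h := h0 0
    rwa [(γ₁.trans γ₂).source] at h
  -- the intermediate loop `c₁` of forms `f + C₁(1,θ)g = f + C₂(0,θ)g` at the point `e₁` of `f + (iRψ/|ψ|)g`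
  obtain ⟨e₁, he₁⟩ := exists_point_of_isNonsingularForm ℂ n d (isHomogeneous_add_smul hf hg (C₁ (1, 0)))
    (hJ₁ (1, 0))
  have h11 : C₁ (1, 0) = C₁ (1, 1) := by
    simp only [hC₁]
    exact fig8Homotopy_bottom_eq_top ψ _ 1
  obtain ⟨c₁, hc₁⟩ := exists_path_pointForm_eq_add_smul n d hf hg (c := fun θ => C₁ (1, θ)) (by fun_prop) h11
    (fun θ => hJ₁ (1, θ)) e₁ he₁
  have hc₁' : ∀ θ, pointForm ℂ n d (c₁ θ) = f + C₁ (1, θ) • g := hc₁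
  have hc₁'' : ∀ θ, pointForm ℂ n d (c₁ θ) = f + C₂ (0, θ) • g := fun θ => by
    rw [hc₁']
    simp only [hC₁, hC₂]
    rw [rotHomotopy_zero_left hψ]
  -- the track `α` of the base point under `C₁`
  obtain ⟨α, hα⟩ := exists_path_pointForm_eq_add_smul' n d hf hg (c := fun s => C₁ (s, 0)) (by fun_prop)
    (fun s => hJ₁ (s, 0)) t₀ e₁ h00 he₁
  have hα' : ∀ t, pointForm ℂ n d (α t) = f + C₁ (t, 0) • g := hα
  have hαt : ∀ t, pointForm ℂ n d (α t) = f + C₁ (t, 1) • g := fun t => by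
    rw [hα']
    simp only [hC₁]
    rw [fig8Homotopy_bottom_eq_top]
  -- the big circle `B` is the loop of forms `f + C₂(1,θ)g`; the track `β` of the base point under `C₂`
  have hB' : ∀ θ, pointForm ℂ n d (B θ) = f + C₂ (1, θ) • g := fun θ => by
    rw [hB]
    simp only [hC₂]
    rw [rotHomotopy_one_left]
  have ht₁ : pointForm ℂ n d t₁ = f + C₂ (1, 0) • g := by
    have h := hB' 0
    rwa [B.source] at h
  have he₁' : pointForm ℂ n d e₁ = f + C₂ (0, 0) • g := by
    have h := hc₁'' 0
    rwa [c₁.source] at h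
  obtain ⟨β, hβ⟩ := exists_path_pointForm_eq_add_smul' n d hf hg (c := fun s => C₂ (s, 0)) (by fun_prop)
    (fun s => hJ₂ (s, 0)) e₁ t₁ he₁' ht₁
  have hβ' : ∀ t, pointForm ℂ n d (β t) = f + C₂ (t, 0) • g := hβ
  have hβt : ∀ t, pointForm ℂ n d (β t) = f + C₂ (t, 1) • g := fun t => by
    rw [hβ']
    simp only [hC₂]
    rw [rotHomotopy_bottom_eq_top]
  have hκ : ∀ t, ∃ b : ℂ, b ≠ 0 ∧ b ≠ ψ ∧ ‖b‖ ≤ R ∧ pointForm ℂ n d ((α.trans β) t) = f + b • g :=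
    fun t => by
    rw [Path.trans_apply]
    split_ifs
    exacts [⟨_, (hmem₁ _).1, (hmem₁ _).2.1, (hmem₁ _).2.2, hα' _⟩,
      ⟨_, (hmem₂ _).1, (hmem₂ _).2.1, (hmem₂ _).2.2, hβ' _⟩]
  exact ⟨C₁, C₂, e₁, c₁, α, β, hC₁c, hC₂c, hJ₁, hJ₂, h0, hc₁', hα', hαt, hc₁'', hB', hβ', hβt, hκ⟩

/-- **The figure-eight is conjugate to the big circle.** Let `f, g` be homogeneous of degree `d`, `ψ ≠ 0`,
`3|ψ|/2 ≤ R`, and suppose `f + b·g` is nonsingular for all `b ≠ 0, ψ` with `|b| ≤ R`. Let `γ₁`, `γ₂` be loops of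
`U(ℂ)` at `t₀` with forms `f + ((ψ/2)e^{2πiθ})g` and `f + (ψ - (ψ/2)e^{2πiθ})g` (the circles around the critical
values `0` and `ψ`, based at the midpoint), and `B` a loop at `t₁` with forms `f + (Re^{2πiθ})g` (the circle
round both). Then there is a path `κ` from `t₀` to `t₁`, all of whose forms are `f + b·g` with `b ≠ 0, ψ`,
`|b| ≤ R`, with **`[γ₁·γ₂] = [κ]·[B]·[κ]⁻¹`** in the fundamental groupoid of `U(ℂ)`.
[cite: ArnoldGuseinzadeVarchenko2012, Part I §2.5 (the loop round all the critical values is homotopic to the product of the simple loops, Fig. 18; Lemma 2.4)]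
[cite: Hatcher2002, §1.1 Lemma 1.19 (p. 37)] [cite: VoisinHodgeII2003, §3.1.1 and §6.2.1] -/
theorem mk_figureEight_eq_conj {f g : MvPolynomial (Fin (n + 2)) ℂ} (hf : f.IsHomogeneous d)
    (hg : g.IsHomogeneous d) {ψ : ℂ} (hψ : ψ ≠ 0) {R : ℝ} (hR : 3 / 2 * ‖ψ‖ ≤ R)
    (hJ : ∀ b : ℂ, b ≠ 0 → b ≠ ψ → ‖b‖ ≤ R → SmoothHypersurface.IsNonsingularForm ℂ (f + b • g))
    {t₀ t₁ : ComplexPoints (base ℂ n d)} (γ₁ γ₂ : Path t₀ t₀) (B : Path t₁ t₁)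
    (h₁ : ∀ θ : unitInterval, pointForm ℂ n d (γ₁ θ) =
      f + (ψ / 2 * Complex.exp (2 * Real.pi * Complex.I * ((θ : ℝ) : ℂ))) • g)
    (h₂ : ∀ θ : unitInterval, pointForm ℂ n d (γ₂ θ) =
      f + (ψ - ψ / 2 * Complex.exp (2 * Real.pi * Complex.I * ((θ : ℝ) : ℂ))) • g)
    (hB : ∀ θ : unitInterval, pointForm ℂ n d (B θ) =
      f + ((R : ℂ) * Complex.exp (2 * Real.pi * Complex.I * ((θ : ℝ) : ℂ))) • g) :
    ∃ κ : Path t₀ t₁,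
      (∀ t, ∃ b : ℂ, b ≠ 0 ∧ b ≠ ψ ∧ ‖b‖ ≤ R ∧ pointForm ℂ n d (κ t) = f + b • g) ∧
      Path.Homotopic.Quotient.mk (γ₁.trans γ₂) =
        (Path.Homotopic.Quotient.mk κ).trans
          ((Path.Homotopic.Quotient.mk B).trans (Path.Homotopic.Quotient.mk κ).symm) := by
  obtain ⟨C₁, C₂, e₁, c₁, α, β, hC₁, hC₂, hJ₁, hJ₂, h0, hc₁, hαb, hαt, hc₁', hB', hβb, hβt, hκ⟩ :=
    exists_figureEight_data hf hg hψ hR hJ γ₁ γ₂ B h₁ h₂ hB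
  have e1 := mk_eq_conj_of_pencilHomotopy hf hg hC₁ hJ₁ (γ₁.trans γ₂) c₁ α h0 hc₁ hαb hαt
  have e2 := mk_eq_conj_of_pencilHomotopy hf hg hC₂ hJ₂ c₁ B β hc₁' hB' hβb hβt
  refine ⟨α.trans β, hκ, ?_⟩
  rw [e1, e2, ← Path.Homotopic.Quotient.mk_symm (α.trans β), Path.trans_symm,
    Path.Homotopic.Quotient.mk_trans, Path.Homotopic.Quotient.mk_trans, Path.Homotopic.Quotient.mk_symm,
    Path.Homotopic.Quotient.mk_symm]
  simp only [Path.Homotopic.Quotient.trans_assoc]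

/-- **The same in the indexing `loopClassUniv` of the rational transports** (`Set.univ ⊆ U(ℂ)`, the path `κ`
pushed by `toUniv`): `loopClassUniv (γ₁·γ₂) = [κ]·loopClassUniv B·[κ]⁻¹`.
[cite: ArnoldGuseinzadeVarchenko2012, Part I §2.5 (Fig. 18; Lemma 2.4)] [cite: Hatcher2002, §1.1 Lemma 1.19 (p. 37)]
[cite: VoisinHodgeII2003, §3.1.2] -/
theorem loopClassUniv_figureEight_eq_conj {f g : MvPolynomial (Fin (n + 2)) ℂ} (hf : f.IsHomogeneous d)
    (hg : g.IsHomogeneous d) {ψ : ℂ} (hψ : ψ ≠ 0) {R : ℝ} (hR : 3 / 2 * ‖ψ‖ ≤ R)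
    (hJ : ∀ b : ℂ, b ≠ 0 → b ≠ ψ → ‖b‖ ≤ R → SmoothHypersurface.IsNonsingularForm ℂ (f + b • g))
    {t₀ t₁ : ComplexPoints (base ℂ n d)} (γ₁ γ₂ : Path t₀ t₀) (B : Path t₁ t₁)
    (h₁ : ∀ θ : unitInterval, pointForm ℂ n d (γ₁ θ) =
      f + (ψ / 2 * Complex.exp (2 * Real.pi * Complex.I * ((θ : ℝ) : ℂ))) • g)
    (h₂ : ∀ θ : unitInterval, pointForm ℂ n d (γ₂ θ) =
      f + (ψ - ψ / 2 * Complex.exp (2 * Real.pi * Complex.I * ((θ : ℝ) : ℂ))) • g)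
    (hB : ∀ θ : unitInterval, pointForm ℂ n d (B θ) =
      f + ((R : ℂ) * Complex.exp (2 * Real.pi * Complex.I * ((θ : ℝ) : ℂ))) • g) :
    ∃ κ : Path t₀ t₁,
      (∀ t, ∃ b : ℂ, b ≠ 0 ∧ b ≠ ψ ∧ ‖b‖ ≤ R ∧ pointForm ℂ n d (κ t) = f + b • g) ∧
      loopClassUniv n d (γ₁.trans γ₂) =
        (Path.Homotopic.Quotient.mk (κ.map (toUniv n d).continuous)).trans
          ((loopClassUniv n d B).trans
            (Path.Homotopic.Quotient.mk (κ.map (toUniv n d).continuous)).symm) := by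
  obtain ⟨C₁, C₂, e₁, c₁, α, β, hC₁, hC₂, hJ₁, hJ₂, h0, hc₁, hαb, hαt, hc₁', hB', hβb, hβt, hκ⟩ :=
    exists_figureEight_data hf hg hψ hR hJ γ₁ γ₂ B h₁ h₂ hB
  have e1 := loopClassUniv_eq_conj_of_pencilHomotopy hf hg hC₁ hJ₁ (γ₁.trans γ₂) c₁ α h0 hc₁ hαb hαt
  have e2 := loopClassUniv_eq_conj_of_pencilHomotopy hf hg hC₂ hJ₂ c₁ B β hc₁' hB' hβb hβt
  refine ⟨α.trans β, hκ, ?_⟩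
  rw [e1, e2, Path.map_trans,
    ← Path.Homotopic.Quotient.mk_symm ((α.map (toUniv n d).continuous).trans (β.map (toUniv n d).continuous)),
    Path.trans_symm, Path.Homotopic.Quotient.mk_trans, Path.Homotopic.Quotient.mk_trans,
    Path.Homotopic.Quotient.mk_symm, Path.Homotopic.Quotient.mk_symm]
  simp only [Path.Homotopic.Quotient.trans_assoc]

/-! ### §4 Transport: `T₁ ≫ T₂` is the conjugate of the transport along the big circle -/

/-- The class of a product loop is the product of the classes (in the `loopClassUniv` indexing). [cite: Hatcher2002, §1.1 (p. 27)] -/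
theorem loopClassUniv_trans {s : ComplexPoints (base ℂ n d)} (γ γ' : Path s s) :
    loopClassUniv n d (γ.trans γ') = (loopClassUniv n d γ).trans (loopClassUniv n d γ') := by
  show Path.Homotopic.Quotient.mk ((γ.trans γ').map (toUniv n d).continuous) = _
  rw [Path.map_trans, Path.Homotopic.Quotient.mk_trans]
  rfl

/-- **The transport along `γ₁·γ₂` is the conjugate of the transport along the big circle** (`d ≥ 1`, any
degree `k'`): with the path `κ` of `loopClassUniv_figureEight_eq_conj` there is THE rational transport `K` of
`Rᵏ' π_* ℚ` along `κ`, and for all rational transports `T₁` along `γ₁`, `T₂` along `γ₂` and `T` along the big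
circle `B`, **`T₁ ≫ T₂ = K ≫ T ≫ K⁻¹`** (the monodromy representation is a functor on the fundamental groupoid;
rational transports are unique). [cite: VoisinHodgeII2003, §3.1.2]
[cite: ArnoldGuseinzadeVarchenko2012, Part I §2.5, Lemma 2.4 (the monodromy round all the critical values is the product of the monodromies of the simple loops)]
[cite: Hatcher2002, §1.1 Lemma 1.19 (p. 37)] -/
theorem figureEight_ratTransport_eq_conj {f g : MvPolynomial (Fin (n + 2)) ℂ} (hf : f.IsHomogeneous d)
    (hg : g.IsHomogeneous d) {ψ : ℂ} (hψ : ψ ≠ 0) {R : ℝ} (hR : 3 / 2 * ‖ψ‖ ≤ R)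
    (hJ : ∀ b : ℂ, b ≠ 0 → b ≠ ψ → ‖b‖ ≤ R → SmoothHypersurface.IsNonsingularForm ℂ (f + b • g))
    (hd : 1 ≤ d) (hU : IsCohomologicallyLocallyTrivialOn (family ℂ n d) Set.univ) (k' : ℕ)
    {t₀ t₁ : ComplexPoints (base ℂ n d)} (γ₁ γ₂ : Path t₀ t₀) (B : Path t₁ t₁)
    (h₁ : ∀ θ : unitInterval, pointForm ℂ n d (γ₁ θ) =
      f + (ψ / 2 * Complex.exp (2 * Real.pi * Complex.I * ((θ : ℝ) : ℂ))) • g)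
    (h₂ : ∀ θ : unitInterval, pointForm ℂ n d (γ₂ θ) =
      f + (ψ - ψ / 2 * Complex.exp (2 * Real.pi * Complex.I * ((θ : ℝ) : ℂ))) • g)
    (hB : ∀ θ : unitInterval, pointForm ℂ n d (B θ) =
      f + ((R : ℂ) * Complex.exp (2 * Real.pi * Complex.I * ((θ : ℝ) : ℂ))) • g) :
    ∃ (κ : Path t₀ t₁) (K : bettiCohomology (fiberOver (family ℂ n d) t₀) k' ≃ₗ[ℚ]
        bettiCohomology (fiberOver (family ℂ n d) t₁) k'),
      (∀ t, ∃ b : ℂ, b ≠ 0 ∧ b ≠ ψ ∧ ‖b‖ ≤ R ∧ pointForm ℂ n d (κ t) = f + b • g) ∧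
      IsRatTransport (family ℂ n d) k' hU (Path.Homotopic.Quotient.mk (κ.map (toUniv n d).continuous)) K ∧
      ∀ (T₁ T₂ : bettiCohomology (fiberOver (family ℂ n d) t₀) k' ≃ₗ[ℚ]
          bettiCohomology (fiberOver (family ℂ n d) t₀) k')
        (T : bettiCohomology (fiberOver (family ℂ n d) t₁) k' ≃ₗ[ℚ]
          bettiCohomology (fiberOver (family ℂ n d) t₁) k'),
        IsRatTransport (family ℂ n d) k' hU (loopClassUniv n d γ₁) T₁ →
        IsRatTransport (family ℂ n d) k' hU (loopClassUniv n d γ₂) T₂ →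
        IsRatTransport (family ℂ n d) k' hU (loopClassUniv n d B) T →
          T₁.trans T₂ = K.trans (T.trans K.symm) := by
  obtain ⟨κ, hκ, hconj⟩ := loopClassUniv_figureEight_eq_conj hf hg hψ hR hJ γ₁ γ₂ B h₁ h₂ hB
  obtain ⟨K, hK⟩ := exists_isRatTransport_family hd k' hU
    (Path.Homotopic.Quotient.mk (κ.map (toUniv n d).continuous))
  refine ⟨κ, K, hκ, hK, fun T₁ T₂ T hT₁ hT₂ hT => ?_⟩
  have h12 : IsRatTransport (family ℂ n d) k' hU (loopClassUniv n d (γ₁.trans γ₂)) (T₁.trans T₂) := by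
    rw [loopClassUniv_trans]
    exact hT₁.trans (family ℂ n d) k' hU hT₂
  have h' := isRatTransport_conj_of_loopClassUniv_eq hU hconj hK hT
  exact LinearEquiv.ext fun v => ofRatClass_injective k' ((h12 v).trans (h' v).symm)

/-- **Equal traces**: consequently `tr(T₁ ≫ T₂) = tr(T)` — the trace of the monodromy round both critical values,
read on the figure-eight at the midpoint, equals the trace of the monodromy of the big circle (conjugate
endomorphisms have equal traces). [cite: VoisinHodgeII2003, §3.1.2]
[cite: ArnoldGuseinzadeVarchenko2012, Part I §2.5, Lemma 2.4] -/
theorem figureEight_trace_eq {f g : MvPolynomial (Fin (n + 2)) ℂ} (hf : f.IsHomogeneous d)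
    (hg : g.IsHomogeneous d) {ψ : ℂ} (hψ : ψ ≠ 0) {R : ℝ} (hR : 3 / 2 * ‖ψ‖ ≤ R)
    (hJ : ∀ b : ℂ, b ≠ 0 → b ≠ ψ → ‖b‖ ≤ R → SmoothHypersurface.IsNonsingularForm ℂ (f + b • g))
    (hd : 1 ≤ d) (hU : IsCohomologicallyLocallyTrivialOn (family ℂ n d) Set.univ) (k' : ℕ)
    {t₀ t₁ : ComplexPoints (base ℂ n d)} (γ₁ γ₂ : Path t₀ t₀) (B : Path t₁ t₁)
    (h₁ : ∀ θ : unitInterval, pointForm ℂ n d (γ₁ θ) =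
      f + (ψ / 2 * Complex.exp (2 * Real.pi * Complex.I * ((θ : ℝ) : ℂ))) • g)
    (h₂ : ∀ θ : unitInterval, pointForm ℂ n d (γ₂ θ) =
      f + (ψ - ψ / 2 * Complex.exp (2 * Real.pi * Complex.I * ((θ : ℝ) : ℂ))) • g)
    (hB : ∀ θ : unitInterval, pointForm ℂ n d (B θ) =
      f + ((R : ℂ) * Complex.exp (2 * Real.pi * Complex.I * ((θ : ℝ) : ℂ))) • g)
    {T₁ T₂ : bettiCohomology (fiberOver (family ℂ n d) t₀) k' ≃ₗ[ℚ]
      bettiCohomology (fiberOver (family ℂ n d) t₀) k'}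
    {T : bettiCohomology (fiberOver (family ℂ n d) t₁) k' ≃ₗ[ℚ] bettiCohomology (fiberOver (family ℂ n d) t₁) k'}
    (hT₁ : IsRatTransport (family ℂ n d) k' hU (loopClassUniv n d γ₁) T₁)
    (hT₂ : IsRatTransport (family ℂ n d) k' hU (loopClassUniv n d γ₂) T₂)
    (hT : IsRatTransport (family ℂ n d) k' hU (loopClassUniv n d B) T) :
    LinearMap.trace ℚ _ (T₁.trans T₂ : bettiCohomology (fiberOver (family ℂ n d) t₀) k' →ₗ[ℚ]
        bettiCohomology (fiberOver (family ℂ n d) t₀) k') =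
      LinearMap.trace ℚ _ (T : bettiCohomology (fiberOver (family ℂ n d) t₁) k' →ₗ[ℚ]
        bettiCohomology (fiberOver (family ℂ n d) t₁) k') := by
  obtain ⟨κ, K, -, -, h⟩ := figureEight_ratTransport_eq_conj hf hg hψ hR hJ hd hU k' γ₁ γ₂ B h₁ h₂ hB
  rw [h T₁ T₂ T hT₁ hT₂ hT]
  have e : (K.trans (T.trans K.symm) : bettiCohomology (fiberOver (family ℂ n d) t₀) k' →ₗ[ℚ]
      bettiCohomology (fiberOver (family ℂ n d) t₀) k') =
      K.symm.conj (T : bettiCohomology (fiberOver (family ℂ n d) t₁) k' →ₗ[ℚ]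
        bettiCohomology (fiberOver (family ℂ n d) t₁) k') := by
    refine LinearMap.ext fun v => ?_
    simp [LinearEquiv.conj_apply]
  rw [e, LinearMap.trace_conj']

/-! ### §5 Two-direction pencil homotopies; moving the centre of a pencil circle (B5b of the programme) -/

/-- **Two-direction lift through the coefficient chart**: if `C, D : X → ℂ` are continuous and every
`f + C(x)·g + D(x)·g'` is nonsingular, then `x ↦ [f + C(x)·g + D(x)·g']` is a continuous map `X → U(ℂ)` with
the prescribed forms (the one-direction case is `exists_continuousMap_pointForm_eq_add_smul` of
`PencilCircleHomotopy`). [cite: VoisinHodgeII2003, §6.2.1] [cite: SerreGAGA1956, §2 n°5] -/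
theorem exists_continuousMap_pointForm_eq_add_smul_add_smul {X : Type*} [TopologicalSpace X]
    {f g g' : MvPolynomial (Fin (n + 2)) ℂ} (hf : f.IsHomogeneous d) (hg : g.IsHomogeneous d)
    (hg' : g'.IsHomogeneous d) {C D : X → ℂ} (hC : Continuous C) (hD : Continuous D)
    (hJ : ∀ x, SmoothHypersurface.IsNonsingularForm ℂ (f + C x • g + D x • g')) :
    ∃ Φ : C(X, ComplexPoints (base ℂ n d)), ∀ x, pointForm ℂ n d (Φ x) = f + C x • g + D x • g' := by
  let a : X → DegIndex n d → ℂ := fun x m => coeff m.1 f + C x * coeff m.1 g + D x * coeff m.1 g'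
  have hform : ∀ x, formOfCoeffs (a x) = f + C x • g + D x • g' := fun x => by
    have h1 : a x = (fun m : DegIndex n d => coeff m.1 (f + C x • g + D x • g')) :=
      funext fun m => by simp [a, coeff_add, coeff_smul, smul_eq_mul]
    rw [h1, formOfCoeffs_coeff]
    exact isHomogeneous_add_smul (isHomogeneous_add_smul hf hg _) hg' _
  have hJ' : ∀ x, SmoothHypersurface.IsNonsingularForm ℂ (formOfCoeffs (a x)) := fun x => by
    rw [hform]; exact hJ x
  have ha : Continuous a := continuous_pi fun m =>
    (continuous_const.add (hC.mul continuous_const)).add (hD.mul continuous_const)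
  refine ⟨⟨fun x => pointOfCoeffs ℂ n d (a x) (hJ' x), continuous_pointOfCoeffs_comp ℂ n d ha hJ'⟩,
    fun x => ?_⟩
  change pointForm ℂ n d (pointOfCoeffs ℂ n d (a x) (hJ' x)) = _
  rw [pointForm_pointOfCoeffs, hform]

/-- **Free homotopies of loops in a two-direction family conjugate.** Let `C, D : [0,1]² → ℂ` be continuous with
every `f + C(t,θ)·g + D(t,θ)·g'` nonsingular, let `c₀`, `c₁` be loops of `U(ℂ)` whose forms are those at `t = 0`,
`t = 1`, and `α` a path whose forms are those at `θ = 0` and at `θ = 1`. Then `[c₀] = [α]·[c₁]·[α]⁻¹` in the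
fundamental groupoid of `U(ℂ)`. [cite: Hatcher2002, §1.1 Lemma 1.19 (p. 37)] [cite: VoisinHodgeII2003, §3.1.1 and §6.2.1] -/
theorem mk_eq_conj_of_pencilHomotopy₂ {f g g' : MvPolynomial (Fin (n + 2)) ℂ} (hf : f.IsHomogeneous d)
    (hg : g.IsHomogeneous d) (hg' : g'.IsHomogeneous d) {C D : unitInterval × unitInterval → ℂ}
    (hC : Continuous C) (hD : Continuous D)
    (hJ : ∀ p, SmoothHypersurface.IsNonsingularForm ℂ (f + C p • g + D p • g'))
    {e₀ e₁ : ComplexPoints (base ℂ n d)} (c₀ : Path e₀ e₀) (c₁ : Path e₁ e₁) (α : Path e₀ e₁)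
    (h₀ : ∀ θ, pointForm ℂ n d (c₀ θ) = f + C (0, θ) • g + D (0, θ) • g')
    (h₁ : ∀ θ, pointForm ℂ n d (c₁ θ) = f + C (1, θ) • g + D (1, θ) • g')
    (hb : ∀ t, pointForm ℂ n d (α t) = f + C (t, 0) • g + D (t, 0) • g')
    (ht : ∀ t, pointForm ℂ n d (α t) = f + C (t, 1) • g + D (t, 1) • g') :
    Path.Homotopic.Quotient.mk c₀ =
      (Path.Homotopic.Quotient.mk α).trans
        ((Path.Homotopic.Quotient.mk c₁).trans (Path.Homotopic.Quotient.mk α).symm) := by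
  obtain ⟨Φ, hΦ⟩ := exists_continuousMap_pointForm_eq_add_smul_add_smul
    (X := unitInterval × unitInterval) hf hg hg' hC hD hJ
  exact MeridianConj.mk_eq_conj_of_square Φ c₀ c₁ α
    (fun θ => pointForm_injective ℂ n d (by rw [hΦ, h₀]))
    (fun θ => pointForm_injective ℂ n d (by rw [hΦ, h₁]))
    (fun t => pointForm_injective ℂ n d (by rw [hΦ, hb]))
    (fun t => pointForm_injective ℂ n d (by rw [hΦ, ht]))

/-- The same relation in the indexing `loopClassUniv` of the rational transports, `α` pushed into `Set.univ` by
`toUniv`. [cite: Hatcher2002, §1.1 Lemma 1.19 (p. 37)] [cite: VoisinHodgeII2003, §3.1.2] -/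
theorem loopClassUniv_eq_conj_of_pencilHomotopy₂ {f g g' : MvPolynomial (Fin (n + 2)) ℂ}
    (hf : f.IsHomogeneous d) (hg : g.IsHomogeneous d) (hg' : g'.IsHomogeneous d)
    {C D : unitInterval × unitInterval → ℂ} (hC : Continuous C) (hD : Continuous D)
    (hJ : ∀ p, SmoothHypersurface.IsNonsingularForm ℂ (f + C p • g + D p • g'))
    {e₀ e₁ : ComplexPoints (base ℂ n d)} (c₀ : Path e₀ e₀) (c₁ : Path e₁ e₁) (α : Path e₀ e₁)
    (h₀ : ∀ θ, pointForm ℂ n d (c₀ θ) = f + C (0, θ) • g + D (0, θ) • g')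
    (h₁ : ∀ θ, pointForm ℂ n d (c₁ θ) = f + C (1, θ) • g + D (1, θ) • g')
    (hb : ∀ t, pointForm ℂ n d (α t) = f + C (t, 0) • g + D (t, 0) • g')
    (ht : ∀ t, pointForm ℂ n d (α t) = f + C (t, 1) • g + D (t, 1) • g') :
    loopClassUniv n d c₀ =
      (Path.Homotopic.Quotient.mk (α.map (toUniv n d).continuous)).trans
        ((loopClassUniv n d c₁).trans
          (Path.Homotopic.Quotient.mk (α.map (toUniv n d).continuous)).symm) := by
  obtain ⟨Φ, hΦ⟩ := exists_continuousMap_pointForm_eq_add_smul_add_smul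
    (X := unitInterval × unitInterval) hf hg hg' hC hD hJ
  exact MeridianConj.mk_eq_conj_of_square ((toUniv n d).comp Φ) (c₀.map (toUniv n d).continuous)
    (c₁.map (toUniv n d).continuous) (α.map (toUniv n d).continuous)
    (fun θ => congrArg (toUniv n d) (pointForm_injective ℂ n d (by rw [hΦ, h₀])))
    (fun θ => congrArg (toUniv n d) (pointForm_injective ℂ n d (by rw [hΦ, h₁])))
    (fun t => congrArg (toUniv n d) (pointForm_injective ℂ n d (by rw [hΦ, hb])))
    (fun t => congrArg (toUniv n d) (pointForm_injective ℂ n d (by rw [hΦ, ht])))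

/-- **Moving the centre of a pencil circle conjugates.** Let `f₁, g₂, g₀` be homogeneous of degree `d`,
`a', r ∈ ℂ`, and suppose every `f₁ + (s a')·g₂ + (r e^{2πiθ})·g₀` (`s ∈ [0,1]`) is nonsingular — the circle of
"radius" `r` in the direction `g₀` stays off the discriminant while its centre moves from `f₁` to `f₁ + a'g₂`.
If `c₀` is a loop with forms `f₁ + (re^{2πiθ})g₀` and `c₁` a loop with forms `f₁ + a'g₂ + (re^{2πiθ})g₀`, then
there is a path `α` from the base point of `c₀` to that of `c₁` with forms `f₁ + (t a')g₂ + r g₀` and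
`[c₀] = [α]·[c₁]·[α]⁻¹`, both in the fundamental groupoid of `U(ℂ)` and in the `loopClassUniv` indexing.
[cite: VoisinHodgeII2003, §2.3.1 and §3.1.1–3.1.2] [cite: Hatcher2002, §1.1 Lemma 1.19 (p. 37)]
[cite: ArnoldGuseinzadeVarchenko2012, Part I §2.5] -/
theorem exists_path_movingCentre_conj {f₁ g₂ g₀ : MvPolynomial (Fin (n + 2)) ℂ} (hf₁ : f₁.IsHomogeneous d)
    (hg₂ : g₂.IsHomogeneous d) (hg₀ : g₀.IsHomogeneous d) (a' r : ℂ)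
    (hJ : ∀ s θ : unitInterval, SmoothHypersurface.IsNonsingularForm ℂ
      (f₁ + (((s : ℝ) : ℂ) * a') • g₂ + (r * Complex.exp (2 * Real.pi * Complex.I * ((θ : ℝ) : ℂ))) • g₀))
    {s₀ s₁ : ComplexPoints (base ℂ n d)} (c₀ : Path s₀ s₀) (c₁ : Path s₁ s₁)
    (h₀ : ∀ θ : unitInterval, pointForm ℂ n d (c₀ θ) =
      f₁ + (r * Complex.exp (2 * Real.pi * Complex.I * ((θ : ℝ) : ℂ))) • g₀)
    (h₁ : ∀ θ : unitInterval, pointForm ℂ n d (c₁ θ) =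
      f₁ + a' • g₂ + (r * Complex.exp (2 * Real.pi * Complex.I * ((θ : ℝ) : ℂ))) • g₀) :
    ∃ α : Path s₀ s₁,
      (∀ t : unitInterval, pointForm ℂ n d (α t) = f₁ + (((t : ℝ) : ℂ) * a') • g₂ + r • g₀) ∧
      Path.Homotopic.Quotient.mk c₀ =
        (Path.Homotopic.Quotient.mk α).trans
          ((Path.Homotopic.Quotient.mk c₁).trans (Path.Homotopic.Quotient.mk α).symm) ∧
      loopClassUniv n d c₀ =
        (Path.Homotopic.Quotient.mk (α.map (toUniv n d).continuous)).trans
          ((loopClassUniv n d c₁).trans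
            (Path.Homotopic.Quotient.mk (α.map (toUniv n d).continuous)).symm) := by
  have hC : Continuous fun p : unitInterval × unitInterval => ((p.1 : ℝ) : ℂ) * a' := by fun_prop
  have hD : Continuous fun p : unitInterval × unitInterval =>
      r * Complex.exp (2 * Real.pi * Complex.I * ((p.2 : ℝ) : ℂ)) := by fun_prop
  have hJ' : ∀ p : unitInterval × unitInterval, SmoothHypersurface.IsNonsingularForm ℂ
      (f₁ + (((p.1 : ℝ) : ℂ) * a') • g₂ +
        (r * Complex.exp (2 * Real.pi * Complex.I * ((p.2 : ℝ) : ℂ))) • g₀) := fun p => hJ p.1 p.2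
  -- the track of the base point: forms `f₁ + (t a') g₂ + r g₀`
  have hJα : ∀ t : unitInterval, SmoothHypersurface.IsNonsingularForm ℂ
      (f₁ + (((t : ℝ) : ℂ) * a') • g₂ + r • g₀) := fun t => by
    simpa using hJ t 0
  obtain ⟨Φ, hΦ⟩ := exists_continuousMap_pointForm_eq_add_smul_add_smul (X := unitInterval) hf₁ hg₂ hg₀
    (C := fun t : unitInterval => ((t : ℝ) : ℂ) * a') (D := fun _ => r) (by fun_prop) continuous_const hJα
  have hs₀ : pointForm ℂ n d s₀ = f₁ + r • g₀ := by
    have h := h₀ 0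
    rw [c₀.source] at h
    rw [h]; simp
  have hs₁ : pointForm ℂ n d s₁ = f₁ + a' • g₂ + r • g₀ := by
    have h := h₁ 1
    rw [c₁.target] at h
    rw [h]; simp [Complex.exp_two_pi_mul_I]
  have hΦ0 : pointForm ℂ n d (Φ 0) = pointForm ℂ n d s₀ := by rw [hΦ, hs₀]; simp
  have hΦ1 : pointForm ℂ n d (Φ 1) = pointForm ℂ n d s₁ := by rw [hΦ, hs₁]; simp
  let α : Path s₀ s₁ :=
    { toContinuousMap := Φ
      source' := pointForm_injective ℂ n d hΦ0
      target' := pointForm_injective ℂ n d hΦ1 }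
  have hα : ∀ t, pointForm ℂ n d (α t) = f₁ + (((t : ℝ) : ℂ) * a') • g₂ + r • g₀ := hΦ
  have e₀ : ∀ θ : unitInterval, pointForm ℂ n d (c₀ θ) =
      f₁ + ((((0 : unitInterval) : ℝ) : ℂ) * a') • g₂ +
        (r * Complex.exp (2 * Real.pi * Complex.I * ((θ : ℝ) : ℂ))) • g₀ := fun θ => by
    rw [h₀]; simp
  have e₁ : ∀ θ : unitInterval, pointForm ℂ n d (c₁ θ) =
      f₁ + ((((1 : unitInterval) : ℝ) : ℂ) * a') • g₂ +
        (r * Complex.exp (2 * Real.pi * Complex.I * ((θ : ℝ) : ℂ))) • g₀ := fun θ => by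
    rw [h₁]; simp
  have eb : ∀ t : unitInterval, pointForm ℂ n d (α t) =
      f₁ + (((t : ℝ) : ℂ) * a') • g₂ +
        (r * Complex.exp (2 * Real.pi * Complex.I * (((0 : unitInterval) : ℝ) : ℂ))) • g₀ := fun t => by
    rw [hα]; simp
  have et : ∀ t : unitInterval, pointForm ℂ n d (α t) =
      f₁ + (((t : ℝ) : ℂ) * a') • g₂ +
        (r * Complex.exp (2 * Real.pi * Complex.I * (((1 : unitInterval) : ℝ) : ℂ))) • g₀ := fun t => by
    rw [hα]; simp [Complex.exp_two_pi_mul_I]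
  exact ⟨α, hα, mk_eq_conj_of_pencilHomotopy₂ hf₁ hg₂ hg₀ hC hD hJ' c₀ c₁ α e₀ e₁ eb et,
    loopClassUniv_eq_conj_of_pencilHomotopy₂ hf₁ hg₂ hg₀ hC hD hJ' c₀ c₁ α e₀ e₁ eb et⟩

/-- **Transport along a circle with a moving centre** (`d ≥ 1`, any degree `k'`): with the path `α` of
`exists_path_movingCentre_conj` there is THE rational transport `K` of `Rᵏ' π_* ℚ` along `α`, and for all
rational transports `T₀` along `c₀` and `T₁` along `c₁`, **`T₀ = K ≫ T₁ ≫ K⁻¹`**; in particular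
`tr T₀ = tr T₁`. [cite: VoisinHodgeII2003, §3.1.2] [cite: Hatcher2002, §1.1 Lemma 1.19 (p. 37)] -/
theorem movingCentre_ratTransport_eq_conj {f₁ g₂ g₀ : MvPolynomial (Fin (n + 2)) ℂ}
    (hf₁ : f₁.IsHomogeneous d) (hg₂ : g₂.IsHomogeneous d) (hg₀ : g₀.IsHomogeneous d) (a' r : ℂ)
    (hJ : ∀ s θ : unitInterval, SmoothHypersurface.IsNonsingularForm ℂ
      (f₁ + (((s : ℝ) : ℂ) * a') • g₂ + (r * Complex.exp (2 * Real.pi * Complex.I * ((θ : ℝ) : ℂ))) • g₀))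
    (hd : 1 ≤ d) (hU : IsCohomologicallyLocallyTrivialOn (family ℂ n d) Set.univ) (k' : ℕ)
    {s₀ s₁ : ComplexPoints (base ℂ n d)} (c₀ : Path s₀ s₀) (c₁ : Path s₁ s₁)
    (h₀ : ∀ θ : unitInterval, pointForm ℂ n d (c₀ θ) =
      f₁ + (r * Complex.exp (2 * Real.pi * Complex.I * ((θ : ℝ) : ℂ))) • g₀)
    (h₁ : ∀ θ : unitInterval, pointForm ℂ n d (c₁ θ) =
      f₁ + a' • g₂ + (r * Complex.exp (2 * Real.pi * Complex.I * ((θ : ℝ) : ℂ))) • g₀) :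
    ∃ (α : Path s₀ s₁) (K : bettiCohomology (fiberOver (family ℂ n d) s₀) k' ≃ₗ[ℚ]
        bettiCohomology (fiberOver (family ℂ n d) s₁) k'),
      (∀ t : unitInterval, pointForm ℂ n d (α t) = f₁ + (((t : ℝ) : ℂ) * a') • g₂ + r • g₀) ∧
      IsRatTransport (family ℂ n d) k' hU (Path.Homotopic.Quotient.mk (α.map (toUniv n d).continuous)) K ∧
      (∀ (T₀ : bettiCohomology (fiberOver (family ℂ n d) s₀) k' ≃ₗ[ℚ]
          bettiCohomology (fiberOver (family ℂ n d) s₀) k')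
        (T₁ : bettiCohomology (fiberOver (family ℂ n d) s₁) k' ≃ₗ[ℚ]
          bettiCohomology (fiberOver (family ℂ n d) s₁) k'),
        IsRatTransport (family ℂ n d) k' hU (loopClassUniv n d c₀) T₀ →
        IsRatTransport (family ℂ n d) k' hU (loopClassUniv n d c₁) T₁ →
          T₀ = K.trans (T₁.trans K.symm) ∧
          LinearMap.trace ℚ _ (T₀ : bettiCohomology (fiberOver (family ℂ n d) s₀) k' →ₗ[ℚ]
              bettiCohomology (fiberOver (family ℂ n d) s₀) k') =
            LinearMap.trace ℚ _ (T₁ : bettiCohomology (fiberOver (family ℂ n d) s₁) k' →ₗ[ℚ]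
              bettiCohomology (fiberOver (family ℂ n d) s₁) k')) := by
  obtain ⟨α, hα, -, hconj⟩ := exists_path_movingCentre_conj hf₁ hg₂ hg₀ a' r hJ c₀ c₁ h₀ h₁
  obtain ⟨K, hK⟩ : ∃ K : bettiCohomology (fiberOver (family ℂ n d) s₀) k' ≃ₗ[ℚ]
      bettiCohomology (fiberOver (family ℂ n d) s₁) k',
      IsRatTransport (family ℂ n d) k' hU (Path.Homotopic.Quotient.mk (α.map (toUniv n d).continuous)) K :=
    exists_isRatTransport_family hd k' hU (Path.Homotopic.Quotient.mk (α.map (toUniv n d).continuous))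
  refine ⟨α, K, hα, hK, fun T₀ T₁ hT₀ hT₁ => ?_⟩
  have h' := isRatTransport_conj_of_loopClassUniv_eq hU hconj hK hT₁
  have heq : T₀ = K.trans (T₁.trans K.symm) :=
    LinearEquiv.ext fun v => ofRatClass_injective k' ((hT₀ v).trans (h' v).symm)
  refine ⟨heq, ?_⟩
  rw [heq]
  have e : (K.trans (T₁.trans K.symm) : bettiCohomology (fiberOver (family ℂ n d) s₀) k' →ₗ[ℚ]
      bettiCohomology (fiberOver (family ℂ n d) s₀) k') =
      K.symm.conj (T₁ : bettiCohomology (fiberOver (family ℂ n d) s₁) k' →ₗ[ℚ]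
        bettiCohomology (fiberOver (family ℂ n d) s₁) k') := by
    refine LinearMap.ext fun v => ?_
    simp [LinearEquiv.conj_apply]
  rw [e, LinearMap.trace_conj']

end HodgeTheory

end Literature.AlgebraicGeometry.HodgeTheory

end
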